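import Literature.Combinatorics.SimpleGraph.GraphRiemannRoch
import Literature.Combinatorics.SimpleGraph.ChipFiringTrichotomy
import HarnessLib

/-!
# Linear equivalence = reachability by chip-firing moves (Baker–Norine Lemma 4.3), the duality
# `D ↦ D⋆ = K⁺ − D` between the dollar game and the Björner–Lovász–Shor game, and `|D| ≠ ∅` iff
# the constrained game from `D⋆` terminates (Baker–Norine 2007, Lemma 5.3, Corollary 5.4)

Source (held, read at the page; statements VERBATIM). M. Baker, S. Norine, *Riemann–Roch and
Abel–Jacobi theory on a finite graph*, Adv. Math. 215 (2007) 766–788 [BakerNorine2007] (held text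
`paper:doi-10-1016-j-aim-2007-04-012` pp. 5–6, 17–18, 22–24). §1.5: «A move consists of a vertex
`v` either borrowing one dollar from each of its neighbors or giving one dollar to each of its
neighbors. […] The object of the game is to reach, through a sequence of moves, a configuration in
which no vertex is in debt. We will call such a configuration a winning position, and a sequence
of moves which achieves such a configuration a winning strategy.» §4.2: «**Lemma 4.3.** Two
divisors `D` and `D′` on `G` are linearly equivalent if and only if there is a sequence of moves
in the chip firing game which transforms the configuration corresponding to `D` into the
configuration corresponding to `D′`. **Proof.** A sequence of moves in the chip-firing game can
be encoded as the function `f ∈ 𝓜(G)` for which `f(v)` is the number of times vertex `v`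
"borrows" a dollar minus the number of time it "lends" a dollar. (Note that the game is
"commutative", in the sense that the order of the moves does not matter.) The ending
configuration, starting from the initial configuration `D` and playing the moves corresponding to
`f`, is given by the divisor `D + Δ(f)`. So the dollar distributions achievable from the initial
configuration `D` are precisely the divisors linearly equivalent to `D`.» §5.5: «The constrained
chip-firing game is played as follows. Each vertex of a given (connected) graph `G` begins with
some nonnegative amount of chips, and a move consists of choosing a vertex with at least as many
chips as its degree, and having it send one chip to each of its neighbors […] The game terminates
when no vertex is able to fire. […] **Theorem 5.2** (Theorem 3.3 of [9]). Let `N` be the number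
of chips […] (a) If `N > 2|E(G)| − |V(G)|`, the game is infinite. (b) […] (c) If `N < |E(G)|`, the
game terminates in a finite number of moves. […] **Lemma 5.3.** A winning strategy exists in the
unconstrained chip-firing game with initial configuration `D` if and only if there is a sequence
of borrowings by vertices having a negative number of dollars which transforms `D` into an
effective divisor. […] For `D ∈ Div(G)`, define `D⋆ = K⁺ − D`, where `K⁺ = Σ_{v ∈ V(G)}
(deg(v) − 1)(v)`. Explicitly, […] `a⋆_v = deg(v) − 1 − a_v`. Note that `a⋆_v ≥ 0` if and only if
`a_v ≤ deg(v) − 1`, and that `(D⋆)⋆ = D`. **Corollary 5.4.** If `D = Σ a_v (v) ∈ Div(G)` with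
`a_v ≤ deg(v) − 1` for all `v ∈ V(G)`, then `|D| ≠ ∅` if and only if there is a legal sequence of
firings in the constrained chip-firing game which starts with the configuration `D⋆` and
terminates in a finite number of moves. **Proof.** By Lemmas 4.3 and 5.3, we have `|D| ≠ ∅` if
and only if there is a sequence of borrowings by (not necessarily distinct) vertices `v₁, …, v_k`
of `G` that leads to a nonnegative divisor […] and such that only vertices which are in debt ever
borrow. Using the definitions, this happens if and only if firing `v₁, …, v_k` in the constrained
chip-firing game beginning at `D⋆` yields a legal sequence of moves ending with a divisor `E⋆`
[…] having `e⋆_v ≤ deg(v) − 1` for all `v ∈ V(G)`. […] (c) If `deg(D) > |E(G)| − |V(G)| = g − 1`,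
the game terminates in a finite number of moves.»

## What is formalised (the constrained game IS the lineage's chip-firing game of `ChipFiring*`:
## `fire`, `run`, `score`, `CanFire`, `IsStable`, `IsLegal`, `IsGame`; divisors as in
## `GraphDivisors`)

* `exists_score_eq` (every `x ≥ 0` is the score of a firing sequence) and **Lemma 4.3**
  **`linEquiv_iff_exists_run`**: `D ∼ D′` iff `D′` is reached from `D` by a sequence of LENDING
  moves alone (a borrowing move is undone by a lending move and, since `Q·1 = 0`, equals the
  lending moves of all other vertices — so «the dollar distributions achievable from the initial
  configuration `D` are precisely the divisors linearly equivalent to `D`» already with lendings);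
  `winnable_iff_exists_run_nonneg` (a winning strategy = a lending sequence to a position with
  nobody in debt);
* the least-action principle behind Lemma 5.3: `ChipFiring.IsLegal.score_le_of_isStable_sub_mulVec` (if
  `s − Qx` is stable for some `x ≥ 0`, every legal firing sequence from `s` has score `≤ x`);
* **`bnDual G D`** (`D⋆ = K⁺ − D`): `bnDual_bnDual` («`(D⋆)⋆ = D`»), `bnDual_nonneg_iff` («`a⋆_v ≥ 0`
  iff `a_v ≤ deg(v) − 1`»), the dictionary `canFire_bnDual_iff` (`v` can fire in `D⋆` iff `v` is
  in debt in `D`), `isStable_bnDual_iff` (`E⋆` is stable iff `E` is effective),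
  `bnDual_fire_bnDual` (firing `v` in `D⋆` = `v` borrowing in `D`), `sum_bnDual`;
* **Lemma 5.3 / Corollary 5.4** **`winnable_iff_exists_isLegal_isStable`** (`|D| ≠ ∅` iff some
  legal firing sequence of the constrained game from `D⋆` terminates), and
  `not_winnable_iff_exists_isGame` (`|D| = ∅` iff the constrained game from `D⋆` is infinite);
* B–N's route to **Theorem 5.2 (c)** through Theorem 1.9: `forall_not_isGame_of_sum_lt_card`
  (with fewer than `|E(G)|` chips every game terminates — here for ARBITRARY integer states, the
  dual of «`deg(D) > g − 1`»).

Definitions with bodies and theorems; no `sorry`; no named facts.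
-/

open Finset SimpleGraph Matrix
open Literature.Combinatorics.SimpleGraph.ChipFiring

namespace Literature.Combinatorics.SimpleGraph.BakerNorine

variable {V : Type*} [Fintype V] [DecidableEq V] (G : SimpleGraph V) [DecidableRel G.Adj]

/-! ### §1 Lemma 4.3: linear equivalence is reachability -/

section Moves

omit [Fintype V] in
/-- Every non-negative integer vector is the score of some firing sequence («the game is
"commutative", in the sense that the order of the moves does not matter»).
[cite: BakerNorine2007, Lemma 4.3 (proof)] -/
theorem exists_score_eq [Fintype V] {x : V → ℤ} (hx : 0 ≤ x) : ∃ σ : List V, score σ = x := by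
  obtain ⟨n, hn⟩ := Int.eq_ofNat_of_zero_le (Finset.sum_nonneg fun v (_ : v ∈ univ) => hx v)
  induction n generalizing x with
  | zero =>
    refine ⟨[], ?_⟩
    rw [score_nil]
    have hn0 : ∑ v, x v = 0 := by exact_mod_cast hn
    exact (funext fun v => (Finset.sum_eq_zero_iff_of_nonneg fun v _ => hx v).1 hn0 v (mem_univ v)).symm
  | succ n ih =>
    obtain ⟨v, hv⟩ : ∃ v, 0 < x v := by
      by_contra hcon
      push Not at hcon
      have : ∑ v, x v ≤ 0 := Finset.sum_nonpos fun v _ => hcon v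
      push_cast at hn
      omega
    have hx' : 0 ≤ x - Pi.single v 1 := fun u => by
      rw [Pi.zero_apply, Pi.sub_apply]
      by_cases hu : u = v
      · subst hu
        rw [Pi.single_eq_same]
        linarith
      · rw [Pi.single_eq_of_ne hu, sub_zero]
        exact hx u
    obtain ⟨σ, hσ⟩ := ih hx' (by
      simp only [Pi.sub_apply, Finset.sum_sub_distrib, Finset.sum_pi_single', mem_univ, if_true]
      push_cast at hn ⊢
      omega)
    exact ⟨v :: σ, by rw [score_cons, hσ, sub_add_cancel]⟩

/-- **Lemma 4.3.** «Two divisors `D` and `D′` on `G` are linearly equivalent if and only if there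
is a sequence of moves in the chip firing game which transforms the configuration corresponding
to `D` into the configuration corresponding to `D′`» — and lending moves suffice (a borrowing by
`v` has the same effect as a lending by every other vertex, `Q·1 = 0`).
[cite: BakerNorine2007, Lemma 4.3] -/
theorem linEquiv_iff_exists_run (D D' : V → ℤ) : LinEquiv G D D' ↔ ∃ σ : List V, run G D σ = D' := by
  constructor
  · intro h
    obtain ⟨f, rfl⟩ := (linEquiv_iff_exists_eq_sub G D D').1 h
    cases isEmpty_or_nonempty V with
    | inl hV => exact ⟨[], funext fun v => isEmptyElim v⟩
    | inr hV =>
      -- shift `f` by its minimum: `x = f − (min f)·1 ≥ 0` has `Qx = Qf`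
      obtain ⟨m, -, hm⟩ := Finset.exists_min_image univ f univ_nonempty
      have hx : (0 : V → ℤ) ≤ fun v => f v - f m := fun v => by
        rw [Pi.zero_apply]
        exact sub_nonneg.2 (hm v (mem_univ v))
      obtain ⟨σ, hσ⟩ := exists_score_eq hx
      refine ⟨σ, ?_⟩
      rw [run_eq_sub_mulVec_score, hσ]
      have hconst : G.lapMatrix ℤ *ᵥ ((fun v => f v - f m) - f) = 0 :=
        (lapMatrix_int_mulVec_eq_zero_iff G _).2 fun i j _ => by simp
      rw [Matrix.mulVec_sub, sub_eq_zero] at hconst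
      rw [hconst]
  · rintro ⟨σ, rfl⟩
    exact linEquiv_run G D σ

/-- A winning strategy is a sequence of (lending) moves to «a configuration in which no vertex is
in debt»: `|D| ≠ ∅` iff some firing sequence from `D` reaches a non-negative state.
[cite: BakerNorine2007, §1.5–§1.6 and Lemma 4.3] -/
theorem winnable_iff_exists_run_nonneg (D : V → ℤ) : Winnable G D ↔ ∃ σ : List V, 0 ≤ run G D σ := by
  constructor
  · rintro ⟨E, hE, hDE⟩
    obtain ⟨σ, rfl⟩ := (linEquiv_iff_exists_run G D E).1 hDE
    exact ⟨σ, hE⟩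
  · rintro ⟨σ, hσ⟩
    exact ⟨run G D σ, hσ, linEquiv_run G D σ⟩

end Moves

/-! ### §2 The least-action principle -/

section LeastAction

variable {G}

/-- **Least action.** If `s − Qx` is a stable state for some `x ≥ 0`, then every legal firing
sequence from `s` fires each vertex at most `x_v` times (the engine of Lemma 5.3's maximal
`f′ ≤ f`, and of Corollary 14.9.4 of Godsil–Royle for `x` a score).
[cite: BakerNorine2007, Lemma 5.3 (proof)] -/
theorem _root_.Literature.Combinatorics.SimpleGraph.ChipFiring.IsLegal.score_le_of_isStable_sub_mulVec
    {s x : V → ℤ} {σ : List V} (hσ : IsLegal G s σ)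
    (hx : 0 ≤ x) (hst : IsStable G (s - G.lapMatrix ℤ *ᵥ x)) : score σ ≤ x := by
  induction σ generalizing s x with
  | nil =>
    rw [score_nil]
    exact hx
  | cons v σ ih =>
    rw [isLegal_cons] at hσ
    -- the first firing of `v` is only possible if `x_v ≥ 1`
    have hxv : 1 ≤ x v := by
      by_contra hlt
      have h0 : (0 : ℤ) ≤ x v := hx v
      have hx0 : x v = 0 := by omega
      have hst_v := (isStable_iff G _).1 hst v
      rw [Pi.sub_apply, SimpleGraph.lapMatrix_mulVec_apply, hx0, mul_zero, zero_sub,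
        sub_neg_eq_add] at hst_v
      have hsum : (0 : ℤ) ≤ ∑ u ∈ G.neighborFinset v, x u :=
        Finset.sum_nonneg fun u _ => (hx u : (0 : ℤ) ≤ x u)
      have hcan := (canFire_iff G s v).1 hσ.1
      omega
    have hx' : (0 : V → ℤ) ≤ x - Pi.single v 1 := fun u => by
      rw [Pi.zero_apply, Pi.sub_apply]
      by_cases hu : u = v
      · subst hu
        rw [Pi.single_eq_same]
        linarith
      · rw [Pi.single_eq_of_ne hu, sub_zero]
        exact hx u
    have hst' : IsStable G (fire G s v - G.lapMatrix ℤ *ᵥ (x - Pi.single v 1)) := by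
      rw [fire_eq_sub_mulVec, Matrix.mulVec_sub, sub_sub_sub_cancel_right]
      exact hst
    have hih := ih hσ.2 hx' hst'
    rw [score_cons]
    intro u
    have h1 := hih u
    rw [Pi.sub_apply] at h1
    rw [Pi.add_apply]
    linarith

/-- Consequently, if `s − Qx` is stable for some `x ≥ 0`, no chip-firing game from `s` is infinite.
[cite: BakerNorine2007, Lemma 5.3 (proof) and Remark 5.5] -/
theorem not_isGame_of_isStable_sub_mulVec {s x : V → ℤ} (hx : 0 ≤ x)
    (hst : IsStable G (s - G.lapMatrix ℤ *ᵥ x)) (f : ℕ → V) : ¬IsGame G s f := by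
  intro hf
  obtain ⟨n, hn⟩ := Int.eq_ofNat_of_zero_le (Finset.sum_nonneg fun v (_ : v ∈ univ) => hx v)
  have hL := hf (n + 1)
  have hle := hL.score_le_of_isStable_sub_mulVec hx hst
  have hlen := sum_score ((List.range (n + 1)).map f)
  rw [List.length_map, List.length_range] at hlen
  have : ∑ v, score ((List.range (n + 1)).map f) v ≤ ∑ v, x v := Finset.sum_le_sum fun v _ => hle v
  rw [hlen, hn] at this
  push_cast at this
  omega

end LeastAction

/-! ### §3 The duality `D ↦ D⋆ = K⁺ − D` -/

section Dual

/-- **`D⋆ = K⁺ − D`**, «where `K⁺ = Σ_{v ∈ V(G)} (deg(v) − 1)(v)`. Explicitly […]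
`a⋆_v = deg(v) − 1 − a_v`». [cite: BakerNorine2007, §5.5 (before Corollary 5.4)] -/
def bnDual (D : V → ℤ) : V → ℤ := fun v => (G.degree v : ℤ) - 1 - D v

omit [DecidableEq V] in
/-- Unfolding `D⋆`. [cite: BakerNorine2007, §5.5] -/
theorem bnDual_apply (D : V → ℤ) (v : V) : bnDual G D v = (G.degree v : ℤ) - 1 - D v := rfl

omit [DecidableEq V] in
/-- «`(D⋆)⋆ = D`.» [cite: BakerNorine2007, §5.5] -/
theorem bnDual_bnDual (D : V → ℤ) : bnDual G (bnDual G D) = D := by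
  funext v
  rw [bnDual_apply, bnDual_apply]
  ring

omit [DecidableEq V] in
/-- «Note that `a⋆_v ≥ 0` if and only if `a_v ≤ deg(v) − 1`.» [cite: BakerNorine2007, §5.5] -/
theorem bnDual_nonneg_iff (D : V → ℤ) (v : V) : 0 ≤ bnDual G D v ↔ D v ≤ G.degree v - 1 := by
  rw [bnDual_apply]
  omega

omit [DecidableEq V] in
/-- The dictionary, I: `v` is ready to fire in `D⋆` iff `v` is in debt in `D` («only vertices
which are in debt ever borrow»). [cite: BakerNorine2007, Corollary 5.4 (proof)] -/
theorem canFire_bnDual_iff (D : V → ℤ) (v : V) : CanFire G (bnDual G D) v ↔ D v < 0 := by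
  rw [canFire_iff, bnDual_apply]
  omega

omit [DecidableEq V] in
/-- The dictionary, II: `E⋆` is a stable (terminal) configuration iff `E` is effective («ending
with a divisor `E⋆` having `e⋆_v ≤ deg(v) − 1` for all `v`»).
[cite: BakerNorine2007, Corollary 5.4 (proof)] -/
theorem isStable_bnDual_iff (E : V → ℤ) : IsStable G (bnDual G E) ↔ 0 ≤ E := by
  rw [isStable_iff]
  refine ⟨fun h v => ?_, fun h v => ?_⟩
  · have := h v
    rw [bnDual_apply] at this
    rw [Pi.zero_apply]
    linarith
  · have : (0 : ℤ) ≤ E v := h v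
    rw [bnDual_apply]
    linarith

/-- `(D − Qy)⋆ = D⋆ + Qy`: lending in `D` is borrowing in `D⋆`. [cite: BakerNorine2007, §5.5] -/
theorem bnDual_sub_mulVec (D y : V → ℤ) :
    bnDual G (D - G.lapMatrix ℤ *ᵥ y) = bnDual G D + G.lapMatrix ℤ *ᵥ y := by
  funext v
  simp only [bnDual_apply, Pi.sub_apply, Pi.add_apply]
  ring

/-- The dictionary, III: firing `v` in `D⋆` is «having `v` borrow a dollar from each of its
neighbors» in `D` (`D + Δ(χ_{v})`). [cite: BakerNorine2007, Lemma 5.3 (proof) and Corollary 5.4 (proof)] -/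
theorem bnDual_fire_bnDual (D : V → ℤ) (v : V) :
    bnDual G (fire G (bnDual G D) v) = D + G.lapMatrix ℤ *ᵥ Pi.single v 1 := by
  rw [fire_eq_sub_mulVec]
  funext u
  simp only [bnDual_apply, Pi.sub_apply, Pi.add_apply]
  ring

/-- After a firing sequence from `D⋆` with score `x`, the dual position is `D + Qx`.
[cite: BakerNorine2007, Corollary 5.4 (proof)] -/
theorem bnDual_run_bnDual (D : V → ℤ) (σ : List V) :
    bnDual G (run G (bnDual G D) σ) = D + G.lapMatrix ℤ *ᵥ score σ := by
  rw [run_eq_sub_mulVec_score]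
  funext u
  simp only [bnDual_apply, Pi.sub_apply, Pi.add_apply]
  ring

omit [DecidableEq V] in
/-- `deg(D⋆) = 2|E(G)| − |V(G)| − deg(D)` («Then `deg(D) = 2|E(G)| − |V(G)| − N`»).
[cite: BakerNorine2007, §5.5 (after Corollary 5.4)] -/
theorem sum_bnDual (D : V → ℤ) :
    ∑ v, bnDual G D v = 2 * (#G.edgeFinset : ℤ) - Fintype.card V - ∑ v, D v := by
  simp only [bnDual_apply, Finset.sum_sub_distrib, Finset.sum_const, Finset.card_univ]
  rw [← Nat.cast_sum, G.sum_degrees_eq_twice_card_edges]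
  push_cast
  ring

end Dual

/-! ### §4 Lemma 5.3 and Corollary 5.4 -/

section ConstrainedGame

/-- **Lemma 5.3 / Corollary 5.4.** «`|D| ≠ ∅` if and only if there is a legal sequence of firings
in the constrained chip-firing game which starts with the configuration `D⋆` and terminates in a
finite number of moves» (equivalently, Lemma 5.3: a winning strategy exists iff some sequence of
borrowings by vertices in debt makes `D` effective). B–N's hypothesis `a_v ≤ deg(v) − 1` only
makes `D⋆` a non-negative configuration (`bnDual_nonneg_iff`); the lineage's legal firing
sequences are defined for all integer states and the equivalence holds for every `D`.
[cite: BakerNorine2007, Lemma 5.3 and Corollary 5.4] -/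
theorem winnable_iff_exists_isLegal_isStable (D : V → ℤ) :
    Winnable G D ↔ ∃ σ : List V, IsLegal G (bnDual G D) σ ∧ IsStable G (run G (bnDual G D) σ) := by
  constructor
  · rintro ⟨E, hE, hDE⟩
    obtain ⟨f, rfl⟩ := (linEquiv_iff_exists_eq_sub G D E).1 hDE
    -- `(D − Qf)⋆ = D⋆ − Q(−f)` is stable; shift `−f` to `x ≥ 0`: no game from `D⋆` is infinite
    rcases exists_isStable_run_or_exists_isGame G (bnDual G D) with h | ⟨g, hg⟩
    · exact h
    · exfalso
      cases isEmpty_or_nonempty V with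
      | inl hV =>
        exact absurd ⟨[], isLegal_nil G _, fun v => isEmptyElim v⟩
          ((not_exists_isStable_run_iff_exists_isGame G (bnDual G D)).2 ⟨g, hg⟩)
      | inr hV =>
        obtain ⟨m, -, hm⟩ := Finset.exists_max_image univ f univ_nonempty
        have hx : (0 : V → ℤ) ≤ fun v => f m - f v := fun v => by
          rw [Pi.zero_apply]
          exact sub_nonneg.2 (hm v (mem_univ v))
        refine not_isGame_of_isStable_sub_mulVec hx ?_ g hg
        have hconst : G.lapMatrix ℤ *ᵥ ((fun v => f m - f v) + f) = 0 :=
          (lapMatrix_int_mulVec_eq_zero_iff G _).2 fun i j _ => by simp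
        rw [Matrix.mulVec_add, add_eq_zero_iff_eq_neg] at hconst
        rw [hconst, sub_neg_eq_add, ← bnDual_sub_mulVec, isStable_bnDual_iff]
        exact hE
  · rintro ⟨σ, -, hst⟩
    refine ⟨bnDual G (run G (bnDual G D) σ), ?_, ?_⟩
    · rw [← isStable_bnDual_iff G, bnDual_bnDual]
      exact hst
    · rw [bnDual_run_bnDual, linEquiv_iff_exists_eq_sub]
      exact ⟨-score σ, by rw [Matrix.mulVec_neg, sub_neg_eq_add]⟩

/-- `|D| = ∅` iff the constrained chip-firing game from `D⋆` is infinite («(a) If `deg(D) < 0`,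
the game is infinite» is the case `deg(D⋆) > 2|E| − |V|`).
[cite: BakerNorine2007, Corollary 5.4 and §5.5 (a)] -/
theorem not_winnable_iff_exists_isGame (D : V → ℤ) :
    ¬Winnable G D ↔ ∃ f : ℕ → V, IsGame G (bnDual G D) f := by
  rw [winnable_iff_exists_isLegal_isStable, not_exists_isStable_run_iff_exists_isGame]

variable {G} in
/-- **Theorem 5.2 (c) through Theorem 1.9**, for arbitrary integer states: «(c) If
`deg(D) > |E(G)| − |V(G)| = g − 1`, the game terminates in a finite number of moves» — with
fewer than `|E(G)|` chips in total (`deg(s) = 2|E| − |V| − deg(s⋆)`), no chip-firing game on a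
connected graph is infinite. [cite: BakerNorine2007, §5.5 (c) (with Theorem 1.9 and Corollary 5.4)] -/
theorem forall_not_isGame_of_sum_lt_card (hG : G.Connected) {s : V → ℤ}
    (h : ∑ v, s v < #G.edgeFinset) (f : ℕ → V) : ¬IsGame G s f := by
  intro hf
  have hW : Winnable G (bnDual G s) := winnable_of_genus_le_sum hG (by
    rw [sum_bnDual, genus_eq]
    omega)
  have hng := (not_winnable_iff_exists_isGame G (bnDual G s)).2
  rw [bnDual_bnDual] at hng
  exact hng ⟨f, hf⟩ hW

end ConstrainedGame

end Literature.Combinatorics.SimpleGraph.BakerNorine
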